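import Mathlib
import Summits.NavierStokesRegularity.NavierStokesRegularity.Theorems.FilamentSkeletonRssStadiumSegmentTube

/-!
# Route `FilamentSkeletonRss` · cruxes `SkeletonJ1L` (stmt-NavierStokesRegularity-23296, registered stub `stub_tangentSkeletonL` ≡
# `TangentSkeletonNearStraightL`, stmt-23320) · line `child_tangent_analytic_strip_L` (b0b56c52900dd90a), stub `stub_stripPropagation` —
# brick for the freeze step of `rcore`: ε-TUBE DEFORMATION OF A WHOLE POLYGONAL SOURCE CONTOUR

Sequel of `Theorems.StadiumSegmentTube` (one sloped segment).  The complex part of the quarter-width TENT of a target is a POLYGONAL path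
`P 0 → P 1 → ⋯ → P n` (left foot point → long plateau → target → short plateau → descent → right foot point,
`Theorems.StadiumCornerRightNear` / `Theorems.StadiumPlateauLeftLong`), and the tent of a nearby target is the polygon `P' 0 → ⋯ → P' n` with
every vertex moved by less than `δ/2`.  If the integrand is holomorphic (in the source) on the `δ`-tubes about all segments of the first polygon
(for the quarter-width kernel: `Theorems.StadiumAnchorTube.anchor_tube`), the segment-wise tube shifts telescope:
  `Σ_{k<n} [P k, P (k+1)] + [P n, P' n] = [P 0, P' 0] + Σ_{k<n} [P' k, P' (k+1)]`   (`polygonal_tube_shift`)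
as segment integrals `[a, b] = ∫₀¹ (b − a) • f(a + t(b − a)) dt` — the two polygons differ by the two END junctions only (which, in the tent, lie
on the real axis and are absorbed by the feet).  Values in any complete complex normed space.  Induction on `n` over
`Theorems.StadiumSegmentTube.segmentIntegral_tube_shift`.
HONEST FRAMING: a complex-analysis brick for the bookkeeping of a HYPOTHETICAL filament skeleton on the NEGATIVE side of a MODEL route; the stub
`stub_stripPropagation` is NOT closed by this file, `TangentSkeletonNearStraightL` / `SkeletonJ1L` stay OPEN; nothing here bears on Navier–Stokes
regularity or blow-up.  `--supports stmt-NavierStokesRegularity-23320` (≡ stub `stub_tangentSkeletonL` of 23296).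
-/

set_option linter.dupNamespace false

noncomputable section

namespace Summit.NavierStokesRegularity.NavierStokesRegularity.Theorems.StadiumPolygonalTubeShift

open Set Metric MeasureTheory Complex Finset
open Summit.NavierStokesRegularity.NavierStokesRegularity.Theorems.StadiumSegmentTube

variable {E : Type*} [NormedAddCommGroup E] [NormedSpace ℝ E] [NormedSpace ℂ E] [IsScalarTower ℝ ℂ E] [CompleteSpace E]

/-- **Tube deformation of a polygonal contour.**  `f` holomorphic on `U`; two vertex sequences `P, P'`; the open `δ`-discs about every point
of every segment `[P k, P (k+1)]`, `k < n`, lie in `U`; every vertex `P' k`, `k ≤ n`, is within `δ/2` of `P k`.  Then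
`Σ_{k<n} [P k, P (k+1)] + [P n, P' n] = [P 0, P' 0] + Σ_{k<n} [P' k, P' (k+1)]` as segment integrals. [folklore] -/
theorem polygonal_tube_shift {U : Set ℂ} {f : ℂ → E} (hf : DifferentiableOn ℂ f U) (P P' : ℕ → ℂ) {δ : ℝ} (hδ : 0 < δ) :
    ∀ n : ℕ, (∀ k < n, ∀ t ∈ Icc (0:ℝ) 1, ball (P k + (t : ℂ) * (P (k+1) - P k)) δ ⊆ U) →
      (∀ k ≤ n, dist (P' k) (P k) < δ / 2) →
      (∑ k ∈ range n, ∫ t in (0:ℝ)..1, (P (k+1) - P k) • f (P k + (t : ℂ) * (P (k+1) - P k))) +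
          (∫ t in (0:ℝ)..1, (P' n - P n) • f (P n + (t : ℂ) * (P' n - P n))) =
        (∫ t in (0:ℝ)..1, (P' 0 - P 0) • f (P 0 + (t : ℂ) * (P' 0 - P 0))) +
          ∑ k ∈ range n, ∫ t in (0:ℝ)..1, (P' (k+1) - P' k) • f (P' k + (t : ℂ) * (P' (k+1) - P' k)) := by
  intro n
  induction n with
  | zero =>
    intro _ _
    simp
  | succ n ih =>
    intro htube hclose
    have htube' : ∀ k < n, ∀ t ∈ Icc (0:ℝ) 1, ball (P k + (t : ℂ) * (P (k+1) - P k)) δ ⊆ U :=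
      fun k hk => htube k (Nat.lt_succ_of_lt hk)
    have hclose' : ∀ k ≤ n, dist (P' k) (P k) < δ / 2 := fun k hk => hclose k (Nat.le_succ_of_le hk)
    have hIH := ih htube' hclose'
    -- the last segment: `[P n, P (n+1)] + [P (n+1), P' (n+1)] = [P n, P' n] + [P' n, P' (n+1)]`
    have hlast := segmentIntegral_tube_shift hf hδ (htube n (Nat.lt_succ_self n)) (hclose n (Nat.le_succ n))
      (hclose (n+1) le_rfl)
    rw [Finset.sum_range_succ, Finset.sum_range_succ, add_assoc, hlast, ← add_assoc, hIH, add_assoc]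

end Summit.NavierStokesRegularity.NavierStokesRegularity.Theorems.StadiumPolygonalTubeShift

end
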